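import Summits.KontsevichZagierPeriods.KontsevichZagierPeriods.Theorems.IsogenyCertificatesXMapKernelStubHuberWustholzSplitting
import Summits.KontsevichZagierPeriods.KontsevichZagierPeriods.Theorems.EffectiveXMapChains.Negative.PeriodRep
import Literature.NumberTheory.EllipticCurves.RealPeriodProofs

/-!
# `XMapKernel`, line `isogeny-orbit-collapse` — stub **R-b1**: class reduction

Support file for the crux `IsogenyCertificates.XMapKernel` (stmt-KontsevichZagierPeriods-10663),
line `isogeny-orbit-collapse`, stub `stub_classReduction` (R-b1).

**Statement (R-b1).** Over the Huber–Wüstholz fact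
`Literature.NumberTheory.Transcendental.HuberWustholzManyCurvePeriods` (a HYPOTHESIS here, never
asserted), a vanishing rational combination `∑ᵢ qᵢ Ωᵢ = 0` of the full real periods
`Ωᵢ = ∫_{Pᵢ > 0} dx/√Pᵢ` of the nonsingular integral cubics `Pᵢ = x³ + Aᵢx + Bᵢ` vanishes on
every LATTICE-ISOGENY CLASS: for each `i` there is a lattice `L₀` with invariants
`(g₂, g₃) = (−4Aᵢ, −4Bᵢ)` (the lattice of `y² = Pᵢ` with `℘ = x`, `℘' = 2y`) such that for every
`S` which is exactly the set of indices `j` whose lattice (the lattice with invariants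
`(−4Aⱼ, −4Bⱼ)`) receives a non-zero multiple of `Λ₀`, the partial sum `∑_{j ∈ S} qⱼ Ωⱼ` vanishes.

**Proof.** For each `j` the tree's uniformisation link
`WeierstrassCurve.exists_periodPair_realPeriod_eq_holds` (Silverman AEC VI.5.1 + C.16) applied to
the short model `curve Aⱼ Bⱼ = ⟨0, 0, 0, Aⱼ, Bⱼ⟩` (`c₄ = −48Aⱼ`, `c₆ = −864Bⱼ`) gives a period pair
`Lⱼ` with `g₂ = −4Aⱼ`, `g₃ = −4Bⱼ` and `Ω(curve) = nⱼ · Ω₀ⱼ`, `nⱼ ∈ {1, 2}` the number of real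
components and `Ω₀ⱼ = min {t > 0 | t ∈ Λⱼ}`; `Lⱼ` is a real lattice (real invariants,
`PeriodPair.isReal_of_g₂_g₃_real` over `uniformization_unique_holds`), so `Ω₀ⱼ ∈ Λⱼ`
(`IsReal.minRealPeriod_mem_lattice`), `Ω₀ⱼ = aⱼ ω₁⁽ʲ⁾ + bⱼ ω₂⁽ʲ⁾` with `aⱼ, bⱼ ∈ ℤ`. By
`setIntegral_rep`, `Ωⱼ = Ω(curve Aⱼ Bⱼ)`, so the relation reads, in `ℂ`,
`∑ⱼ (βⱼ ω₁⁽ʲ⁾ + β'ⱼ ω₂⁽ʲ⁾) = 0` with the RATIONAL coefficients `βⱼ = qⱼ nⱼ aⱼ`, `β'ⱼ = qⱼ nⱼ bⱼ`.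
The landed conditional stub T (`stub_huberWustholzSplitting_of`: the relation splits along the
classes of `PeriodPair.IsIsogenousTo`) applies; its class predicate `Λᵢ ~ Λⱼ` is equivalent to
R-b1's (`∃ L' α, g₂(L') = −4Aⱼ ∧ g₃(L') = −4Bⱼ ∧ α ≠ 0 ∧ αΛᵢ ⊆ Λ_{L'}`) with `L₀ := Lᵢ`, because a
lattice with the invariants of `Lⱼ` IS `Λⱼ` (`PeriodPair.uniformization_unique_holds`). Casting
T's conclusion back to `ℝ` gives the claim. No definitions, no new named facts.

References: Silverman, *The Arithmetic of Elliptic Curves* (2009), Thm. VI.5.1, C.16;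
Huber–Wüstholz, *Transcendence and linear relations of 1-periods* (2022), Thm. 15.3;
Baker–Wüstholz, *Logarithmic Forms and Diophantine Geometry* (2007), §6.2 Thm. 6.4.
-/

noncomputable section

namespace Summit.KontsevichZagierPeriods.IsogenyCertificates.XMapKernelStubs.ClassReduction

open scoped BigOperators
open Literature.NumberTheory.Transcendental
open Summit.KontsevichZagierPeriods.IsogenyCertificates.EffectiveXMapChainsNegative

/-- `c₄ = −48A` for the short model `y² = x³ + Ax + B` (`a₁ = a₂ = a₃ = 0`). [folklore] -/
theorem curve_c₄ (A B : ℤ) : (curve A B).c₄ = -48 * (A : ℝ) := by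
  simp only [curve, WeierstrassCurve.c₄, WeierstrassCurve.b₂, WeierstrassCurve.b₄]
  ring

/-- `c₆ = −864B` for the short model `y² = x³ + Ax + B` (`a₁ = a₂ = a₃ = 0`). [folklore] -/
theorem curve_c₆ (A B : ℤ) : (curve A B).c₆ = -864 * (B : ℝ) := by
  simp only [curve, WeierstrassCurve.c₆, WeierstrassCurve.b₂, WeierstrassCurve.b₄,
    WeierstrassCurve.b₆]
  ring

/-- **The real period lattice of `y² = x³ + Ax + B`** (`4A³ + 27B² ≠ 0`): a real period pair `L`
with `g₂(L) = −4A`, `g₃(L) = −4B` whose least positive real period `Ω₀(L)` computes the full real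
period, `∫_{P > 0} dx/√P = n · Ω₀(L)` with `n = numRealComponents ∈ {1, 2}`
(Silverman AEC VI.5.1 + C.16 via the tree's `exists_periodPair_realPeriod_eq_holds`,
`setIntegral_rep`, `isReal_of_g₂_g₃_real`). [cite: SilvermanAEC2009, Thm VI.5.1 and C.16] -/
theorem exists_periodPair {A B : ℤ} (h : 4 * A ^ 3 + 27 * B ^ 2 ≠ 0) :
    ∃ L : PeriodPair, L.g₂ = -4 * (A : ℂ) ∧ L.g₃ = -4 * (B : ℂ) ∧ L.IsReal ∧
      (∫ x in {x : Fin 1 → ℝ | 0 < x 0 ^ 3 + (A : ℝ) * x 0 + (B : ℝ)},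
          1 / Real.sqrt (x 0 ^ 3 + (A : ℝ) * x 0 + (B : ℝ))) =
        (curve A B).numRealComponents * L.minRealPeriod := by
  haveI := curve_isElliptic h
  obtain ⟨L, h₂, h₃, hΩ⟩ := (curve A B).exists_periodPair_realPeriod_eq_holds
  have hreal : L.IsReal :=
    PeriodPair.isReal_of_g₂_g₃_real PeriodPair.uniformization_unique_holds
      (by rw [h₂, Complex.ofReal_im]) (by rw [h₃, Complex.ofReal_im])
  rw [curve_c₄] at h₂
  rw [curve_c₆] at h₃
  refine ⟨L, ?_, ?_, hreal, ?_⟩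
  · rw [h₂]; push_cast; ring
  · rw [h₃]; push_cast; ring
  · rw [setIntegral_rep A B 1, one_mul, hΩ, PeriodPair.minRealPeriod_def]

/-- **R-b1 — class reduction** over the Huber–Wüstholz fact (taken as a hypothesis): a vanishing
`ℚ`-combination `∑ᵢ qᵢ Ωᵢ = 0` of full real periods `Ωᵢ = ∫_{Pᵢ > 0} dx/√Pᵢ`,
`Pᵢ = x³ + Aᵢx + Bᵢ` nonsingular over `ℤ`, vanishes on each lattice-isogeny class: for each `i`
there is a lattice `L₀` with invariants `(−4Aᵢ, −4Bᵢ)` such that for every `S` that is exactly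
`{j | the lattice with invariants (−4Aⱼ, −4Bⱼ) receives a non-zero multiple of Λ₀}` the partial
sum over `S` vanishes. Proof in the module docstring: real period lattices `Lⱼ`
(`exists_periodPair`), integer coordinates of `Ω₀ⱼ ∈ Λⱼ`, the splitting stub T
(`stub_huberWustholzSplitting_of`) with rational coefficients, and the identification of the two
class predicates by `PeriodPair.uniformization_unique_holds`; `L₀ := Lᵢ`.
[cite: HuberWustholz2022, Thm. 15.3 (1),(3) with §15.2.2; BakerWustholz2007 §6.2 Thm. 6.4] -/
theorem stub_classReduction : Literature.NumberTheory.Transcendental.HuberWustholzManyCurvePeriods → ∀ (k : ℕ) (A B : Fin k → ℤ) (q : Fin k → ℚ), (∀ i, 4 * A i ^ 3 + 27 * B i ^ 2 ≠ 0) → ∑ i, (q i : ℝ) * (∫ x in {x : Fin 1 → ℝ | 0 < x 0 ^ 3 + (A i : ℝ) * x 0 + (B i : ℝ)}, 1 / Real.sqrt (x 0 ^ 3 + (A i : ℝ) * x 0 + (B i : ℝ))) = 0 → ∀ i, ∃ L₀ : PeriodPair, L₀.g₂ = -4 * (A i : ℂ) ∧ L₀.g₃ = -4 * (B i : ℂ)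 ∧ ∀ S : Finset (Fin k), (∀ j, j ∈ S ↔ ∃ (L' : PeriodPair) (α : ℂ), L'.g₂ = -4 * (A j : ℂ) ∧ L'.g₃ = -4 * (B j : ℂ) ∧ α ≠ 0 ∧ ∀ l ∈ L₀.lattice, α * l ∈ L'.lattice) → ∑ j ∈ S, (q j : ℝ) * (∫ x in {x : Fin 1 → ℝ | 0 < x 0 ^ 3 + (A j : ℝ) * x 0 + (B j : ℝ)}, 1 / Real.sqrt (x 0 ^ 3 + (A j : ℝ) * x 0 + (B j : ℝ))) = 0 := by
  intro hHW k A B q hns hsum i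
  -- the real period lattices `Lⱼ`, the integer coordinates of `Ω₀ⱼ ∈ Λⱼ`, `nⱼ ∈ {1, 2}`
  choose L hg₂ hg₃ hreal hΩ using fun j => exists_periodPair (hns j)
  choose a b hab using fun j => PeriodPair.mem_lattice.1 (hreal j).minRealPeriod_mem_lattice
  obtain ⟨n, hn⟩ : ∃ n : Fin k → ℕ, ∀ j, (curve (A j) (B j)).numRealComponents = n j :=
    ⟨_, fun j => rfl⟩
  refine ⟨L i, hg₂ i, hg₃ i, fun S hS => ?_⟩
  simp only [hΩ, hn] at hsum ⊢
  -- the data fed to T: algebraic (rational) invariants and coefficients on `ω₁⁽ʲ⁾, ω₂⁽ʲ⁾`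
  have hLalg : ∀ j, IsAlgebraic ℚ (L j).g₂ ∧ IsAlgebraic ℚ (L j).g₃ := by
    intro j
    refine ⟨?_, ?_⟩
    · have e : (L j).g₂ = ((-4 * A j : ℤ) : ℂ) := by rw [hg₂ j]; push_cast; ring
      rw [e]; exact isAlgebraic_int _
    · have e : (L j).g₃ = ((-4 * B j : ℤ) : ℂ) := by rw [hg₃ j]; push_cast; ring
      rw [e]; exact isAlgebraic_int _
  have hβalg : ∀ j, IsAlgebraic ℚ (((q j * n j * a j : ℚ) : ℂ)) ∧
      IsAlgebraic ℚ (((q j * n j * b j : ℚ) : ℂ)) := fun j =>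
    ⟨isAlgebraic_rat ℚ _, isAlgebraic_rat ℚ _⟩
  have hterm : ∀ j, ((q j * n j * a j : ℚ) : ℂ) * (L j).ω₁ + ((q j * n j * b j : ℚ) : ℂ) * (L j).ω₂
      = (((q j : ℝ) * ((n j : ℝ) * (L j).minRealPeriod) : ℝ) : ℂ) := by
    intro j
    push_cast
    rw [← hab j]
    ring
  have hsum' : ∑ j, (((q j * n j * a j : ℚ) : ℂ) * (L j).ω₁ +
      ((q j * n j * b j : ℚ) : ℂ) * (L j).ω₂) = 0 := by
    rw [Finset.sum_congr rfl fun j _ => hterm j, ← Complex.ofReal_sum, hsum, Complex.ofReal_zero]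
  -- the two class predicates agree (uniqueness of the lattice with given invariants)
  have hS' : ∀ j, j ∈ S ↔ (L i).IsIsogenousTo (L j) := by
    intro j
    rw [hS j]
    constructor
    · rintro ⟨L', α, h₂', h₃', hα, hαL⟩
      have hlat : L'.lattice = (L j).lattice :=
        PeriodPair.uniformization_unique_holds L' (L j) (h₂'.trans (hg₂ j).symm)
          (h₃'.trans (hg₃ j).symm)
      exact ⟨α, hα, fun l hl => hlat ▸ hαL l hl⟩
    · rintro ⟨α, hα, hαL⟩
      exact ⟨L j, α, hg₂ j, hg₃ j, hα, hαL⟩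
  -- T, and back to `ℝ`
  have key : ∑ j ∈ S, (((q j * n j * a j : ℚ) : ℂ) * (L j).ω₁ +
      ((q j * n j * b j : ℚ) : ℂ) * (L j).ω₂) = 0 :=
    HuberWustholzSplitting.stub_huberWustholzSplitting_of hHW k L
      (fun j => ((q j * n j * a j : ℚ) : ℂ)) (fun j => ((q j * n j * b j : ℚ) : ℂ)) hLalg hβalg
      hsum' i S hS'
  rw [Finset.sum_congr rfl fun j _ => hterm j, ← Complex.ofReal_sum] at key
  exact Complex.ofReal_eq_zero.1 key

end Summit.KontsevichZagierPeriods.IsogenyCertificates.XMapKernelStubs.ClassReduction
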